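import Mathlib.MeasureTheory.Constructions.ClosedCompactCylinders
import Mathlib.MeasureTheory.Constructions.ProjectiveFamilyContent
import Mathlib.MeasureTheory.OuterMeasure.OfAddContent
import Mathlib.MeasureTheory.Measure.RegularityCompacts
import Mathlib.Topology.Compactness.CompactSystem
import Mathlib.Analysis.SpecificLimits.Basic
import Literature.Probability.Process.KolmogorovExtension
import HarnessLib

/-!
# Kolmogorov extension theorem: proofs

This file discharges the named fact `Literature.Probability.Process.exists_isProjectiveLimit` of
`Literature/Probability/Process/KolmogorovExtension.lean` — the **Kolmogorov extension theorem**: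
a projective family of probability measures on the finite products of Polish spaces (Borel
σ-algebras) has a projective limit — together with its corollaries stated in that file
(`existsUnique_isProjectiveLimit`, `isProjectiveLimit_projectiveLimit`,
`isProbabilityMeasure_projectiveLimit`, `projectiveLimit_map_restrict`,
`projectiveLimit_cylinder`).

## Proof (Kolmogorov 1933, Ch. III §4; Bochner 1955; Kallenberg, *Foundations*, Thm 6.16)

The classical compact-class argument, in the form of the Lean development of
R. Degenne, P. Pfaffelhuber et al. (Kolmogorov extension project, arXiv:2511.20118, §3), whose
first pieces (`MeasureTheory.projectiveFamilyContent`, `closedCompactCylinders`,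
`IsCompactSystem`, `AddContent.measure`) are in Mathlib at the pin:

* `Literature.Probability.Process.KolmogorovExtension.isCompactSystem_closedCompactCylinders`: cylinders with closed
  compact bases form a *compact system* (a countable family with empty intersection has a finite
  subfamily with empty intersection) — for arbitrary topological coordinate spaces; the proof
  embeds all finite intersections into the compact set `Πᵢ Yᵢ`, `Yᵢ` the projection of the first
  base involving the coordinate `i`, and applies the finite intersection property there.
* `Literature.Probability.Process.KolmogorovExtension.tendsto_zero_of_isCompactSystem`: an additive content on a ring of
  sets which is inner-approximable by members of a compact system is continuous at `∅`
  (Kallenberg Lemma 6.15 / Bochner's compact-class lemma).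
* `Literature.Probability.Process.KolmogorovExtension.exists_closedCompactCylinder_sdiff_le`: the content of a projective
  family of finite measures on Polish spaces is inner-approximable by closed compact cylinders
  (inner regularity of finite Borel measures on Polish spaces, Mathlib
  `MeasurableSet.exists_isCompact_isClosed_sdiff_lt`).
* Hence the content is σ-subadditive (Mathlib `addContent_iUnion_eq_sum_of_tendsto_zero`),
  Carathéodory's construction `AddContent.measure` extends it to the product σ-algebra, and the
  extension is a projective limit (`isProjectiveLimit_measure_projectiveFamilyContent`).

## References

* A. N. Kolmogorov, *Grundbegriffe der Wahrscheinlichkeitsrechnung* (1933), Ch. III §4.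
* O. Kallenberg, *Foundations of Modern Probability*, 2nd ed. (2002), Lemma 6.15, Thm 6.16.
* R. Degenne et al., *Formalization of Brownian motion in Lean*, arXiv:2511.20118 (2025), §3.
-/

open MeasureTheory Set Filter Topology
open scoped ENNReal NNReal

namespace Literature.Probability.Process

namespace KolmogorovExtension

/-! ### Closed compact cylinders form a compact system -/

section CompactSystem

variable {ι : Type*} {X : ι → Type*} [∀ i, TopologicalSpace (X i)]

/-- **Closed compact cylinders form a compact system**: if countably many cylinders with closed
compact bases have all finite intersections nonempty, then their total intersection is
nonempty. No separation axiom is needed: with `x₀` a point of the first cylinder and `Yᵢ` the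
(compact) projection to the coordinate `i` of the base of the first cylinder involving `i`
(`{x₀ i}` if there is none), every finite intersection meets the compact set `Π Yᵢ`, and the
cylinders are closed, so the finite intersection property of `Π Yᵢ` applies.
Kallenberg, *Foundations* (2002), proof of Thm 6.16; Degenne et al. 2025, §3. [cite: Kallenberg2002, Thm 6.16 (proof)] -/
theorem isCompactSystem_closedCompactCylinders :
    IsCompactSystem (closedCompactCylinders X) := by
  classical
  refine IsCompactSystem.of_nonempty_iInter fun C hC hne => ?_
  choose s S hS_closed hS_compact hCeq using fun n => (mem_closedCompactCylinders _).1 (hC n)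
  have hCcl : ∀ n, IsClosed (C n) := fun n => by
    rw [hCeq n]
    exact (hS_closed n).preimage (continuous_pi fun j => continuous_apply _)
  have hmem : ∀ n (y : ∀ i, X i), y ∈ C n ↔ (s n).restrict y ∈ S n := fun n y => by
    rw [hCeq n, mem_cylinder]
  -- every `C n` is nonempty, hence so is every base `S n`
  have hCne : ∀ n, (C n).Nonempty := fun n => (hne n).mono (dissipate_subset le_rfl)
  obtain ⟨x₀, -⟩ := hCne 0
  -- the compact coordinate sets `Y i`
  let Y : ∀ i, Set (X i) := fun i =>
    if h : ∃ n, i ∈ s n then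
      (fun z : (∀ j : ↥(s (Nat.find h)), X j) => z ⟨i, Nat.find_spec h⟩) '' S (Nat.find h)
    else {x₀ i}
  have hYc : ∀ i, IsCompact (Y i) := by
    intro i
    by_cases h : ∃ n, i ∈ s n
    · simp only [Y, dif_pos h]
      exact (hS_compact _).image (continuous_apply _)
    · simp only [Y, dif_neg h]
      exact isCompact_singleton
  have hYmem : ∀ i (h : ∃ n, i ∈ s n) (y : ∀ i, X i), y ∈ C (Nat.find h) → y i ∈ Y i := by
    intro i h y hy
    simp only [Y, dif_pos h]
    exact ⟨(s (Nat.find h)).restrict y, (hmem _ y).1 hy, rfl⟩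
  have hYne : ∀ i, (Y i).Nonempty := by
    intro i
    by_cases h : ∃ n, i ∈ s n
    · obtain ⟨y, hy⟩ := hCne (Nat.find h)
      exact ⟨y i, hYmem i h y hy⟩
    · simp only [Y, dif_neg h]
      exact singleton_nonempty _
  set P : Set (∀ i, X i) := Set.pi univ Y with hP_def
  have hPc : IsCompact P := isCompact_univ_pi hYc
  obtain ⟨z, hz⟩ : P.Nonempty := Set.univ_pi_nonempty_iff.2 hYne
  -- every finite intersection meets `P`
  have hfin : ∀ u : Finset ℕ, (P ∩ ⋂ k ∈ u, C k).Nonempty := by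
    intro u
    set n : ℕ := u.sup id with hn_def
    obtain ⟨y, hy⟩ := hne n
    have hyk : ∀ k, k ≤ n → y ∈ C k := fun k hk => dissipate_subset hk hy
    set F : Finset ι := (Finset.range (n + 1)).biUnion s with hF_def
    have hF : ∀ k, k ≤ n → ∀ i ∈ s k, i ∈ F := fun k hk i hi =>
      Finset.mem_biUnion.2 ⟨k, Finset.mem_range.2 (Nat.lt_succ_of_le hk), hi⟩
    let x : ∀ i, X i := fun i => if i ∈ F then y i else z i
    refine ⟨x, ?_, ?_⟩
    · intro i _
      by_cases hi : i ∈ F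
      · simp only [x, if_pos hi]
        obtain ⟨k, hk, hik⟩ := Finset.mem_biUnion.1 hi
        have h : ∃ n, i ∈ s n := ⟨k, hik⟩
        refine hYmem i h y (hyk _ ((Nat.find_min' h hik).trans ?_))
        exact Nat.le_of_lt_succ (Finset.mem_range.1 hk)
      · simp only [x, if_neg hi]
        exact hz i (mem_univ i)
    · simp only [mem_iInter]
      intro k hk
      have hkn : k ≤ n := Finset.le_sup (f := id) hk
      have h1 : (s k).restrict x = (s k).restrict y := by
        ext j
        simp only [Finset.restrict, x, if_pos (hF k hkn j j.2)]
      rw [hmem, h1, ← hmem]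
      exact hyk k hkn
  exact (hPc.inter_iInter_nonempty C hCcl hfin).mono inter_subset_right

end CompactSystem

/-! ### Continuity at `∅` of contents approximable by a compact system -/

section Content

variable {α : Type*} {C : Set (Set α)}

/-- **Compact-class lemma.** Let `m` be an additive content on a ring of sets `C` and `K` a
compact system such that every `s ∈ C` contains, for every `ε > 0`, some `t ∈ K ∩ C` with
`m (s \ t) ≤ ε`. Then `m` is continuous at `∅`: `m (sₙ) → 0` for every decreasing sequence
`sₙ ∈ C` with empty intersection. (Choose `tₙ ⊆ sₙ` with `m (sₙ \ tₙ) ≤ δₙ`, `∑ δₙ < ε`; the `tₙ`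
have empty intersection, so `⋂ₖ≤N tₖ = ∅` for some `N`, and then
`s_N ⊆ ⋃ₖ≤N (sₖ \ tₖ)` has content `≤ ε`.) Kallenberg, *Foundations* (2002), Lemma 6.15
(Bochner's compact-class criterion). [cite: Kallenberg2002, Lemma 6.15] -/
theorem tendsto_zero_of_isCompactSystem (hC : IsSetRing C) (m : AddContent ℝ≥0∞ C)
    {K : Set (Set α)} (hK : IsCompactSystem K)
    (happrox : ∀ s ∈ C, ∀ ε : ℝ≥0∞, ε ≠ 0 → ∃ t ∈ K, t ∈ C ∧ t ⊆ s ∧ m (s \ t) ≤ ε)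
    ⦃s : ℕ → Set α⦄ (hs : ∀ n, s n ∈ C) (hanti : Antitone s) (hempty : ⋂ n, s n = ∅) :
    Tendsto (fun n => m (s n)) atTop (𝓝 0) := by
  rw [ENNReal.tendsto_atTop_zero]
  intro ε hε
  obtain ⟨δ, hδpos, hδsum⟩ := ENNReal.exists_pos_sum_of_countable' hε.ne' ℕ
  choose t htK htC hts hmt using fun n => happrox (s n) (hs n) (δ n) (hδpos n).ne'
  have htempty : ⋂ n, t n = ∅ :=
    subset_eq_empty (iInter_mono hts) hempty
  obtain ⟨N, hN⟩ := hK t htK htempty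
  refine ⟨N, fun n hn => ?_⟩
  have hsub : s N ⊆ ⋃ k ∈ Finset.range (N + 1), (s k \ t k) := by
    intro x hx
    have hx' : x ∉ dissipate t N := by rw [hN]; exact notMem_empty x
    rw [mem_dissipate] at hx'
    push Not at hx'
    obtain ⟨k, hk, hxk⟩ := hx'
    exact mem_biUnion (Finset.mem_range.2 (Nat.lt_succ_of_le hk)) ⟨hanti hk hx, hxk⟩
  have hdiff : ∀ k, s k \ t k ∈ C := fun k => hC.sdiff_mem (hs k) (htC k)
  calc m (s n) ≤ m (s N) := addContent_mono hC.isSetSemiring (hs n) (hs N) (hanti hn)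
    _ ≤ m (⋃ k ∈ Finset.range (N + 1), (s k \ t k)) :=
        addContent_mono hC.isSetSemiring (hs N) (hC.biUnion_mem _ fun k _ => hdiff k) hsub
    _ ≤ ∑ k ∈ Finset.range (N + 1), m (s k \ t k) :=
        addContent_biUnion_le hC fun k _ => hdiff k
    _ ≤ ∑ k ∈ Finset.range (N + 1), δ k := Finset.sum_le_sum fun k _ => hmt k
    _ ≤ ∑' k, δ k := ENNReal.sum_le_tsum _
    _ ≤ ε := hδsum.le

end Content

/-! ### The Kolmogorov extension -/

section Polish

variable {ι : Type*} {α : ι → Type*} [∀ i, MeasurableSpace (α i)] [∀ i, TopologicalSpace (α i)]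
  [∀ i, PolishSpace (α i)] [∀ i, BorelSpace (α i)]
  {P : ∀ J : Finset ι, Measure (∀ j : J, α j)} [∀ J, IsFiniteMeasure (P J)]

/-- **Inner approximation by closed compact cylinders.** For a projective family of finite
measures on Polish spaces, every measurable cylinder `s` contains, for every `ε > 0`, a cylinder
`t` with closed compact base with `content (s \ t) ≤ ε` (inner regularity of finite Borel
measures on the Polish space `Π_{j ∈ I} α j`). Kallenberg, *Foundations* (2002), proof of
Thm 6.16 (with Lemma 1.? tightness `A.2.3`); Degenne et al. 2025, §3. [cite: Kallenberg2002, Thm 6.16 (proof)] -/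
theorem exists_closedCompactCylinder_sdiff_le (hP : IsProjectiveMeasureFamily P)
    {s : Set (∀ i, α i)} (hs : s ∈ measurableCylinders α) {ε : ℝ≥0∞} (hε : ε ≠ 0) :
    ∃ t ∈ closedCompactCylinders α, t ∈ measurableCylinders α ∧ t ⊆ s ∧
      projectiveFamilyContent hP (s \ t) ≤ ε := by
  obtain ⟨I, S, hS, rfl⟩ := (mem_measurableCylinders s).1 hs
  obtain ⟨K, hKS, hKc, hKcl, hlt⟩ :=
    hS.exists_isCompact_isClosed_sdiff_lt (measure_ne_top (P I) S) hε
  refine ⟨cylinder I K, cylinder_mem_closedCompactCylinders I K hKcl hKc,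
    cylinder_mem_measurableCylinders I K hKcl.measurableSet, fun x hx => ?_, ?_⟩
  · rw [mem_cylinder] at hx ⊢
    exact hKS hx
  · rw [sdiff_cylinder_same, projectiveFamilyContent_cylinder hP (hS.diff hKcl.measurableSet)]
    exact hlt.le

/-- The content of a projective family of finite measures on Polish spaces is continuous at `∅`
(compact-class lemma applied to the closed compact cylinders). Kallenberg, *Foundations*
(2002), proof of Thm 6.16. [cite: Kallenberg2002, Thm 6.16 (proof)] -/
theorem projectiveFamilyContent_tendsto_zero (hP : IsProjectiveMeasureFamily P)
    ⦃s : ℕ → Set (∀ i, α i)⦄ (hs : ∀ n, s n ∈ measurableCylinders α) (hanti : Antitone s)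
    (hempty : ⋂ n, s n = ∅) :
    Tendsto (fun n => projectiveFamilyContent hP (s n)) atTop (𝓝 0) :=
  tendsto_zero_of_isCompactSystem isSetRing_measurableCylinders _
    isCompactSystem_closedCompactCylinders
    (fun _ hs _ hε => exists_closedCompactCylinder_sdiff_le hP hs hε) hs hanti hempty

/-- The content of a projective family of finite measures on Polish spaces is σ-subadditive
(σ-additivity on the ring of measurable cylinders, Mathlib
`addContent_iUnion_eq_sum_of_tendsto_zero`). Kallenberg, *Foundations* (2002), Thm 6.16
(proof). [cite: Kallenberg2002, Thm 6.16 (proof)] -/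
theorem isSigmaSubadditive_projectiveFamilyContent (hP : IsProjectiveMeasureFamily P) :
    (projectiveFamilyContent hP).IsSigmaSubadditive :=
  isSigmaSubadditive_of_addContent_iUnion_eq_tsum isSetRing_measurableCylinders
    fun _ hf hU hdisj => addContent_iUnion_eq_sum_of_tendsto_zero isSetRing_measurableCylinders _
      (fun _ _ => projectiveFamilyContent_ne_top hP) (projectiveFamilyContent_tendsto_zero hP)
      hf hU hdisj

/-- **Kolmogorov extension theorem, explicit form.** The Carathéodory extension
(`AddContent.measure`) of the content of a projective family of finite measures on Polish spaces
to the product σ-algebra is a projective limit of the family. Kolmogorov 1933, Ch. III §4;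
Kallenberg, *Foundations* (2002), Thm 6.16. [cite: Kolmogorov1933, Ch. III §4] [cite: Kallenberg2002, Thm 6.16] -/
theorem isProjectiveLimit_measure_projectiveFamilyContent (hP : IsProjectiveMeasureFamily P) :
    IsProjectiveLimit ((projectiveFamilyContent hP).measure isSetSemiring_measurableCylinders
      generateFrom_measurableCylinders.ge (isSigmaSubadditive_projectiveFamilyContent hP)) P := by
  intro I
  ext s hs
  rw [Measure.map_apply (Finset.measurable_restrict I) hs, ← cylinder, AddContent.measure_eq _ _
    generateFrom_measurableCylinders.symm _ (cylinder_mem_measurableCylinders I s hs)]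
  exact projectiveFamilyContent_cylinder hP hs

end Polish

end KolmogorovExtension

/-! ### Discharge of the named facts of `KolmogorovExtension.lean` -/

section Discharge

variable {ι : Type*} {α : ι → Type*} [∀ i, MeasurableSpace (α i)]

/-- **Kolmogorov extension theorem** (discharge of the named fact `Literature.Probability.Process.exists_isProjectiveLimit`):
a projective family of probability measures on finite products of Polish spaces admits a
projective limit. Kolmogorov 1933, Ch. III §4; Kallenberg, *Foundations* (2002), Thm 6.16.
[cite: Kolmogorov1933, Ch. III §4] [cite: Kallenberg2002, Thm 6.16] -/
theorem exists_isProjectiveLimit_holds : exists_isProjectiveLimit (ι := ι) (α := α) := by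
  intro _ _ _ P _ hP
  exact ⟨_, KolmogorovExtension.isProjectiveLimit_measure_projectiveFamilyContent hP⟩

/-- Discharge of `Literature.Probability.Process.existsUnique_isProjectiveLimit` (existence: `exists_isProjectiveLimit_holds`;
uniqueness: Mathlib `IsProjectiveLimit.unique`). Kallenberg, *Foundations* (2002), Thm 6.16.
[cite: Kallenberg2002, Thm 6.16] -/
theorem existsUnique_isProjectiveLimit_holds : existsUnique_isProjectiveLimit (ι := ι) (α := α) := by
  intro _ _ _ P _ hP
  obtain ⟨μ, hμ⟩ := exists_isProjectiveLimit_holds hP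
  exact ⟨μ, hμ, fun ν hν => hν.unique hμ⟩

/-- Discharge of `Literature.Probability.Process.isProjectiveLimit_projectiveLimit`: under the Kolmogorov hypotheses the
chosen `projectiveLimit P` is a projective limit. Kallenberg, *Foundations* (2002), Thm 6.16.
[cite: Kallenberg2002, Thm 6.16] -/
theorem isProjectiveLimit_projectiveLimit_holds :
    isProjectiveLimit_projectiveLimit (ι := ι) (α := α) := by
  intro _ _ _ P _ hP
  have h : ∃ μ, IsProjectiveLimit μ P := exists_isProjectiveLimit_holds hP
  rw [projectiveLimit, dif_pos h]
  exact h.choose_spec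

/-- Discharge of `Literature.Probability.Process.isProbabilityMeasure_projectiveLimit`. Kallenberg, *Foundations* (2002),
Thm 6.16. [cite: Kallenberg2002, Thm 6.16] -/
theorem isProbabilityMeasure_projectiveLimit_holds :
    isProbabilityMeasure_projectiveLimit (ι := ι) (α := α) := by
  intro _ _ _ P _ hP
  exact (isProjectiveLimit_projectiveLimit_holds hP).isProbabilityMeasure

/-- Discharge of `Literature.Probability.Process.projectiveLimit_map_restrict`. Kallenberg, *Foundations* (2002), Thm 6.16.
[cite: Kallenberg2002, Thm 6.16] -/
theorem projectiveLimit_map_restrict_holds :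
    projectiveLimit_map_restrict (ι := ι) (α := α) := by
  intro _ _ _ P _ hP I
  exact isProjectiveLimit_projectiveLimit_holds hP I

/-- Discharge of `Literature.Probability.Process.projectiveLimit_cylinder`. Kolmogorov 1933, Ch. III §4.
[cite: Kolmogorov1933, Ch. III §4] -/
theorem projectiveLimit_cylinder_holds : projectiveLimit_cylinder (ι := ι) (α := α) := by
  intro _ _ _ P _ hP I S hS
  exact (isProjectiveLimit_projectiveLimit_holds hP).measure_cylinder I hS

end Discharge

end Literature.Probability.Process
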